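import Literature.NumberTheory.EllipticCurves.HalfIntegralWeightFrickeHeckeProofs
import Literature.NumberTheory.EllipticCurves.TunnellFormsFrickeProofs
import Literature.NumberTheory.EllipticCurves.TunnellThmTwoOrdinaryProofs
import HarnessLib

/-!
# Tunnell 1983, Theorem 2 for the character `χ₂`: `g θ₄, g θ₁₆ ∈ S_{3/2}(128, χ₂, φ)` — PROVED

Discharge of the named fact `Tunnell1983_thm2_chi2` of `TunnellHalfIntegralForms`
(`Tunnell1983_thm2_chi2_holds`): Tunnell's forms `g θ₄` and `g θ₁₆` are cusp forms of weight
`3/2`, level `128` and character `χ₂` which are `T(p²)`-eigenforms with the eigenvalues `a_p(E)`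
of the newform `φ` of level `32` (`E : y² = x³ - x`) for every odd prime `p`
(`heckeTSq_tunnellForm_four`, `heckeTSq_tunnellForm_sixteen`), hence lie in the Shimura–Waldspurger
space `S_{3/2}(128, χ₂, φ)`.

## Proof

Tunnell (p. 327) identifies the eigenvalues through Shimura's correspondence [18] and Niwa [11].
Here instead:

* **`g θ₄`.** By `TunnellThmTwoOrdinaryProofs.heckeTSq_tunnellForm_eight` (Jacobi's
  `θ₁' = θ₂θ₃θ₄` and `ℤ[i]`), `T(p²)(g θ₈) = a_p(E) g θ₈` in `S_{3/2}(128, 1)` for every odd `p`.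
  The Fricke involution `(W f)(z) = (-iz)^{-3/2} f(-1/(128 z))` maps `g θ₈` to `32 g θ₄`
  (`TunnellFormsFrickeProofs.tunnellForm_eight_fricke`) and intertwines `T(p²)` on
  `M_{3/2}(128, 1)` with `T(p²)` on `M_{3/2}(128, χ₂)` up to `1̄(p)² = 1`
  (`HalfIntegralWeightFrickeHeckeProofs.heckeTSq_eq_smul_of_frickeFun`, the target character being
  `χ' = 1̄ · (128/·) = χ₂`); so `T(p²)(g θ₄) = a_p(E) g θ₄`.
* **`g θ₁₆`.** `g θ₄ = (g θ₄ - g θ₁₆) + g θ₁₆` is the sum of two `T(p²)`-eigenforms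
  (`TunnellWeightThreeHalvesBasisProofs.heckeTSq_four_sub_sixteen_eigen`,
  `heckeTSq_tunnellForm_sixteen_eigen` — unconditional since the spanning statement (CO) is proved
  there); comparing the coefficients of `q¹` in `T(p²)(g θ₄) = a_p(E) g θ₄`
  (`g θ₄ - g θ₁₆` has no `q¹`, `g θ₁₆` has coefficient `1`) gives the eigenvalue `a_p(E)` of
  `g θ₁₆`.

No definitions, no named facts.

## References

* J. B. Tunnell, *A classical Diophantine problem and modular forms of weight 3/2*, Invent. Math.
  72 (1983) 323–334, Thm. 2 and its proof, pp. 327–328. [Tunnell1983Congruent]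
* G. Shimura, *On modular forms of half integral weight*, Ann. of Math. 97 (1973) 440–481, §1,
  Prop. 1.5, Thm. 1.7. [Shimura1973HalfIntegral]
-/

noncomputable section

open UpperHalfPlane hiding I
open Complex
open scoped NumberTheorySymbols

namespace Literature.NumberTheory.EllipticCurves.Tunnell1983

open Literature.NumberTheory.EllipticCurves.ModularForms

/-! ### The Fricke involution of level `128` in the two normalisations -/

/-- `frickePoint 128 z = frickePt z` (`= -1/(128 z)`). [folklore] -/
theorem frickePoint_eq_frickePt (z : ℍ) : frickePoint 128 z = frickePt z := by
  apply UpperHalfPlane.ext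
  rw [coe_frickePoint, coe_frickePt]
  push_cast
  ring

/-- `r(z) = (-iz)^{1/2} = √(-iz)`. [folklore] -/
theorem frickeR_eq_csqrt (z : ℍ) : frickeR z = Complex.sqrt (-I * (z : ℂ)) := by
  rw [frickeR, Complex.sqrt, one_div]

/-- **`W(g θ₈) = 32 g θ₄`** for `(W f)(z) = √(-iz)⁻³ f(-1/(128 z))` (`frickeFun 128 3`).
[cite: Tunnell1983Congruent, p. 327] -/
theorem frickeFun_tunnellForm_eight (z : ℍ) :
    frickeFun 128 3 (tunnellForm 8) z = 32 * tunnellForm 4 z := by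
  have h0 := csqrt_neg_I_mul_ne_zero z
  unfold frickeFun
  rw [frickePoint_eq_frickePt, tunnellForm_eight_fricke, frickeR_eq_csqrt]
  calc _ = 32 * tunnellForm 4 z *
        ((Complex.sqrt (-I * (z : ℂ)))⁻¹ * Complex.sqrt (-I * (z : ℂ))) ^ 3 := by ring
    _ = _ := by rw [inv_mul_cancel₀ h0, one_pow, mul_one]

/-! ### The characters: `χ₂(p) = 1̄(p) (128/p)` at odd primes -/

/-- An odd prime does not divide `128`. [folklore] -/
theorem not_dvd_of_odd_prime {p : ℕ} (hp : p.Prime) (hp2 : p ≠ 2) : ¬ p ∣ 128 := by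
  intro h
  have h7 : p ∣ 2 ^ 7 := by norm_num; exact h
  exact hp2 ((Nat.prime_dvd_prime_iff_eq hp Nat.prime_two).mp (hp.dvd_of_dvd_pow h7))

/-- `(128/p) = (2/p)` for an odd prime `p`. [folklore] -/
theorem jacobiSym_128 {p : ℕ} (hp : p.Prime) (hp2 : p ≠ 2) : J(((128 : ℕ) : ℤ) | p) = J(2 | p) := by
  have hg : (2 : ℤ).gcd p = 1 := by
    rw [show (2 : ℤ) = ((2 : ℕ) : ℤ) by rfl, Int.gcd_natCast_natCast]
    exact Nat.coprime_two_left.mpr (hp.odd_of_ne_two hp2)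
  rw [show ((128 : ℕ) : ℤ) = 2 ^ (2 * 3 + 1) by norm_num, jacobiSym.pow_left, pow_succ, pow_mul,
    jacobiSym.sq_one hg, one_pow, one_mul]

/-- **`χ₂(p) = 1̄(p) · (128/p)`** for an odd prime `p`: the target character of the Fricke
involution on `M_{3/2}(128, 1)` is `χ₂` (at the primes that matter). [folklore] -/
theorem tunnellChar_eq_one_inv_mul_jacobi {p : ℕ} (hp : p.Prime) (hp2 : p ≠ 2) :
    tunnellChar (p : ZMod 128) =
      ((1 : DirichletCharacter ℂ 128) (p : ZMod 128))⁻¹ * (J(((128 : ℕ) : ℤ) | p) : ℂ) := by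
  have hu : IsUnit (p : ZMod 128) :=
    (ZMod.isUnit_prime_iff_not_dvd hp).mpr (not_dvd_of_odd_prime hp hp2)
  have hodd : Odd (p : ℤ) := by exact_mod_cast hp.odd_of_ne_two hp2
  have h1 : tunnellChar (p : ZMod 128) = (J(2 | p) : ℂ) := by
    have := tunnellChar_apply_of_odd hodd
    rwa [Int.cast_natCast, Int.natAbs_natCast] at this
  rw [MulChar.one_apply hu, inv_one, one_mul, h1, jacobiSym_128 hp hp2]

/-! ### `T(p²)(g θ₄) = a_p(E) g θ₄` and `T(p²)(g θ₁₆) = a_p(E) g θ₁₆` -/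

/-- **`T(p²)(g θ₄) = a_p(E) · g θ₄` for every odd prime `p`**: the Fricke transfer of
`T(p²)(g θ₈) = a_p(E) g θ₈`. [cite: Tunnell1983Congruent, Thm 2 and its proof, pp. 327–328] -/
theorem heckeTSq_tunnellForm_four {p : ℕ} (hp : p.Prime) (hp2 : p ≠ 2) :
    heckeTSq 3 tunnellChar p (qCoeffs (tunnellForm 4)) =
      tunnellEigenvalues p • qCoeffs (tunnellForm 4) := by
  haveI : Fact p.Prime := ⟨hp⟩
  have hpN := not_dvd_of_odd_prime hp hp2
  have h := heckeTSq_eq_smul_of_frickeFun (N := 128) (k := 3)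
    (χ := (1 : DirichletCharacter ℂ 128)) (χ' := tunnellChar) (p := p)
    ⟨16, by norm_num⟩ hpN ⟨1, by norm_num⟩
    (halfIntCuspForms_le_halfIntModularForms _ _ _ tunnellForm_eight_mem_halfIntCuspForms)
    (halfIntCuspForms_le_halfIntModularForms _ _ _ tunnellForm_four_mem_halfIntCuspForms)
    (tunnellChar_eq_one_inv_mul_jacobi hp hp2) (c := 32) (by norm_num)
    frickeFun_tunnellForm_eight (heckeTSq_tunnellForm_eight hp hp2)
  have hu : IsUnit (p : ZMod 128) := (ZMod.isUnit_prime_iff_not_dvd hp).mpr hpN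
  rwa [MulChar.one_apply hu, inv_one, one_pow, one_mul] at h

/-- **`T(p²)(g θ₁₆) = a_p(E) · g θ₁₆` for every odd prime `p`**: `g θ₄ = (g θ₄ - g θ₁₆) + g θ₁₆`
is a sum of two eigenforms, and the coefficient of `q¹` singles out `g θ₁₆`.
[cite: Tunnell1983Congruent, Thm 2 and its proof, pp. 327–328] -/
theorem heckeTSq_tunnellForm_sixteen {p : ℕ} (hp : p.Prime) (hp2 : p ≠ 2) :
    heckeTSq 3 tunnellChar p (qCoeffs (tunnellForm 16)) =
      tunnellEigenvalues p • qCoeffs (tunnellForm 16) := by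
  have h4 := heckeTSq_tunnellForm_four hp hp2
  have h16 := heckeTSq_tunnellForm_sixteen_eigen hp hp2
  have h5 := heckeTSq_four_sub_sixteen_eigen hp hp2
  have hM4 := halfIntCuspForms_le_halfIntModularForms _ _ _ tunnellForm_four_mem_halfIntCuspForms
  have hM16 := halfIntCuspForms_le_halfIntModularForms _ _ _ tunnellForm_sixteen_mem_halfIntCuspForms
  have hsplit : qCoeffs (tunnellForm 4) =
      qCoeffs (tunnellForm 4 - tunnellForm 16) + qCoeffs (tunnellForm 16) := by
    rw [← qCoeffs_add (sub_mem hM4 hM16) hM16, sub_add_cancel]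
  have v4 : qCoeffs (tunnellForm 4) 1 = 1 := qCoeffs_tunnellForm_values.2.2.2.2.1.1
  have v16 : qCoeffs (tunnellForm 16) 1 = 1 := qCoeffs_tunnellForm_values.2.2.2.2.2.1
  have vd : qCoeffs (tunnellForm 4 - tunnellForm 16) 1 = 0 := by
    have := congrFun hsplit 1
    rw [Pi.add_apply, v4, v16] at this
    linear_combination -this
  -- compare the coefficients of `q¹` in `T(p²)(g θ₄) = a_p g θ₄`
  have key := congrFun h4 1
  rw [hsplit, map_add, h5, h16] at key
  simp only [Pi.add_apply, Pi.smul_apply, smul_eq_mul, vd, v16, mul_zero, zero_add, mul_one] at key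
  rw [h16, key]

/-! ### Theorem 2 (character `χ₂`) -/

/-- **Tunnell 1983, Theorem 2 for the character `χ₂`** (the named fact `Tunnell1983_thm2_chi2`,
DISCHARGED): `g θ₄` and `g θ₁₆` lie in `S_{3/2}(128, χ₂, φ)`, i.e. they are cusp forms of weight
`3/2`, level `128`, character `χ₂` (`TunnellFormsCuspidalProofs`) which are `T(p²)`-eigenforms with
the eigenvalues `a_p(E)` for all primes `p ∤ 128`. [cite: Tunnell1983Congruent, Thm 2 (pp. 327–328)] -/
theorem Tunnell1983_thm2_chi2_holds : Tunnell1983_thm2_chi2 := by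
  have hne : ∀ p : ℕ, p.Prime → ¬ p ∣ 128 → p ≠ 2 := by
    rintro p - hpN rfl
    exact hpN ⟨64, by norm_num⟩
  exact ⟨mem_shimuraSubspace_of_isAlmostEigenform tunnellForm_four_mem_halfIntCuspForms
      (isAlmostEigenform_of_forall fun p hp hpN ↦ heckeTSq_tunnellForm_four hp (hne p hp hpN)),
    mem_shimuraSubspace_of_isAlmostEigenform tunnellForm_sixteen_mem_halfIntCuspForms
      (isAlmostEigenform_of_forall fun p hp hpN ↦ heckeTSq_tunnellForm_sixteen hp (hne p hp hpN))⟩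

end Literature.NumberTheory.EllipticCurves.Tunnell1983
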